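import Summits.CriticalPhenomena.SAWScalingLimit.Theses.SAWReversalUpgrade
import HarnessLib

/-!
# Sketch — crux idea `loewner-shield-squeeze` for `SAWReversalUpgrade.NoDeepReturn`
# (stmt-CriticalPhenomena-18004), crux-ideate round 1, ideator 1

Typed first lemmas of the line (nothing here is filed; everything elaborates):

* `basePlus/baseMinus/baseSpan/baseGap` — the images `x_t^± = g_t(0^±)` of the two sides of the
  root under the chordal Loewner map (`Loewner.map`, real points), the total harmonic size
  `S_t = x_t⁺ - x_t⁻` of the hull seen from the target, and the harmonic EXPOSURE of the tip
  `X_t = min (W_t - x_t⁻) (x_t⁺ - W_t)`;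
* `ExposureBound` — FIRST LEMMA (deterministic, Beurling + a Jordan-curve shield argument): a tip
  joined to `ℝ ∪ γ[0,σ]` by a free straight segment is harmonically exposed:
  `X_t ≤ C · S_t · √(max(|γ t|, |q|, sup_{s≤σ}|γ s|) / R)` once the hull has reached radius `R`;
* `SLEBaseSeparation` — the continuum input (Bessel-5/2 behaviour of `x⁺ - W`, `W - x⁻` under
  `√(8/3)B`): the exposure ratio is rarely small while the hull is macroscopic;
* `RootAnnulusCrossingTight` — residual lattice atom no. 1 (K-fold spirals at the root; Euclidean
  annuli — the honest target is its conformal-annulus form, see the card);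
* `NoMacroscopicN` — residual lattice atom no. 2 = the crux at the single coarsest scale: after
  visiting `B(b, ρ)` the walk does not come back within `ρ'` of `a` (the Sheffield–Sun N-curve);
* `ExactRootTouchRare` — technical leak of the route's trimming attachment (exact touches of
  `D.pt 0` by the polyline);
* `SqueezeTransfer` — the line's composition claim, as a `Prop` (NOT proved here):
  `ForwardDriving → LawReversal → ExposureBound → SLEBaseSeparation → RootAnnulusCrossingTight →
   NoMacroscopicN → ExactRootTouchRare → NoDeepReturn`.
-/

noncomputable section

namespace Summit.CriticalPhenomena.SAWScalingLimit.Cruxes.NoDeepReturn.ShieldSqueeze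

open MeasureTheory Filter Topology Set Metric
open scoped NNReal ENNReal
open Literature.Probability.RandomPlanarGeometry
open Literature.Probability.RandomPlanarGeometry.SAW
open Literature.Probability.LatticeModels (Site meshPoint)
open Literature.Probability (Process.preWienerMeasure)

/-- The crux, by name. -/
abbrev Crux : Prop := Summit.CriticalPhenomena.SAWScalingLimit.Theses.SAWReversalUpgrade.NoDeepReturn

/-! ## §1 Loewner base points and the exposure functional (functionals of the driving function) -/

/-- `x_t⁺ = g_t(0⁺)`: infimum over the still-flowing positive real points of their images
(`Loewner.map` is defined on real points; for the driving function of a simple curve touching `ℝ`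
only at `0` no `x ≠ 0` is swallowed and `x ↦ g_t x` is increasing on `(0, ∞)`). -/
def basePlus (W : ℝ≥0 → ℝ) (t : ℝ≥0) : ℝ :=
  sInf ((fun x : ℝ => (Loewner.map W t (x : ℂ)).re) '' Set.Ioi 0)

/-- `x_t⁻ = g_t(0⁻)`. -/
def baseMinus (W : ℝ≥0 → ℝ) (t : ℝ≥0) : ℝ :=
  sSup ((fun x : ℝ => (Loewner.map W t (x : ℂ)).re) '' Set.Iio 0)

/-- `S_t = x_t⁺ - x_t⁻` (= `π ×` harmonic measure from infinity of the two-sided hull boundary). -/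
def baseSpan (W : ℝ≥0 → ℝ) (t : ℝ≥0) : ℝ := basePlus W t - baseMinus W t

/-- Harmonic exposure of the tip: `X_t = min (W_t - x_t⁻) (x_t⁺ - W_t)` (= `π ×` the smaller of
the harmonic measures, from infinity, of the two sides of the curve from the tip back to `0^±`). -/
def baseGap (W : ℝ≥0 → ℝ) (t : ℝ≥0) : ℝ := min (W t - baseMinus W t) (basePlus W t - W t)

/-- The detection event read by `ForwardDriving`: at some capacity time `t ≤ T` the hull is
macroscopic (`s₀ ≤ S_t`) and the tip is `u`-exposed (`X_t ≤ u S_t`). A closed condition on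
`W|[0,T]` modulo the continuity of `x^±` in `W` (part of the transfer stub). -/
def Detected (T : ℝ≥0) (s₀ u : ℝ) (W : ℝ≥0 → ℝ) : Prop :=
  ∃ t : ℝ≥0, t ≤ T ∧ s₀ ≤ baseSpan W t ∧ baseGap W t ≤ u * baseSpan W t

/-! ## §2 FIRST LEMMA — the exposure bound (deterministic; Beurling + Jordan shield) -/

/-- **ExposureBound.** There is an absolute `C` such that: for a continuous driving function `W`
with `W 0 = 0` generating a SIMPLE trace `γ` (capacity parametrisation), a time `t`, a radius
`R > 0` already reached by `γ|[0,t]`, and a point `q` with `|q| ≤ R` that is either REAL or on the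
EARLY arc `γ[0,σ]` (`σ ≤ t`) and is joined to the tip `γ t` by a straight open segment meeting
neither `γ[0,t]` nor `ℝ`, the tip is harmonically exposed:
`X_t ≤ C · S_t · √( max(|γ t|, |q|, sup_{s ≤ σ} |γ s|) / R )`.
Proof sketch (paper): `J := [γ t, q] ∪ γ[σ_q, t]` (resp. `∪ [q, 0]_ℝ` if `q` is real) is a Jordan
curve; one full side of `γ[σ_q,t]` borders its interior, which planar BM from infinity enters only
through the segment; the remaining part of that side lies on `γ[0,σ] ⊆ B̄(0, sup_{s≤σ}|γ s|)`;
Beurling's estimate against the connected set `γ[0,t] ∪ ℝ` joining `0` to `∂B(0,R)` bounds both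
harmonic measures by `C R √(ρ/R)`, while `S_t ≥ c R`. -/
def ExposureBound : Prop :=
  ∃ C : ℝ, 0 < C ∧ ∀ (W : ℝ≥0 → ℝ) (γ : ℝ≥0 → ℂ), Continuous W → W 0 = 0 →
    Loewner.IsGeneratedByCurve W γ → Loewner.IsSimpleTrace γ →
    ∀ (t σ : ℝ≥0) (q : ℂ) (R : ℝ), 0 < R → σ ≤ t → (∃ s ≤ t, R ≤ ‖γ s‖) →
      (q.im = 0 ∨ q ∈ γ '' Set.Icc 0 σ) → ‖q‖ ≤ R →
      openSegment ℝ (γ t) q ∩ (γ '' Set.Icc 0 t ∪ {z : ℂ | z.im = 0}) = ∅ →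
      baseGap W t ≤ C * baseSpan W t *
        Real.sqrt (max ‖γ t‖ (max ‖q‖ (⨆ s : Set.Icc (0 : ℝ≥0) σ, ‖γ s‖)) / R)

/-! ## §3 The continuum input — base separation for the SLE(8/3) driving function -/

/-- **SLEBaseSeparation.** Under `√(8/3)B` the exposure ratio is rarely small while the hull is
macroscopic: for every horizon `T`, floor `s₀ > 0` and `η > 0` there is `u > 0` with
`P[∃ t ≤ T, S_t ≥ s₀ ∧ X_t ≤ u S_t] ≤ η`. (Paper: `x⁺ - W` and `W - x⁻` are time-changed Bessel
processes of dimension `1 + 4/κ = 5/2`, which do not hit `0`; quantitatively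
`P ≤ C (1 + log⁺ (T / s₀²)) √u`.) -/
def SLEBaseSeparation : Prop :=
  ∀ (T : ℝ≥0) (s₀ : ℝ), 0 < s₀ → ∀ η : ℝ, 0 < η → ∃ u : ℝ, 0 < u ∧
    Process.preWienerMeasure {ω | Detected T s₀ u (sleDriving ((8 : ℝ≥0) / 3) ω)} ≤ ENNReal.ofReal η

/-! ## §4 Residual lattice atoms -/

/-- `2K` alternating crossings by the curve `c` of the annulus `A(z₀; r₁, r₂)`: times
`s₁ < s₂ < ⋯ < s_{2K}` with `|c s_{2i-1} - z₀| ≥ r₂` and `|c s_{2i} - z₀| ≤ r₁`. -/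
def HasRootCrossings (K : ℕ) (z₀ : ℂ) (r₁ r₂ : ℝ) (c : unitInterval → ℂ) : Prop :=
  ∃ s : Fin (2 * K) → unitInterval, StrictMono s ∧
    ∀ i : Fin (2 * K), ((i : ℕ) % 2 = 0 → r₂ ≤ dist (c (s i)) z₀) ∧
      ((i : ℕ) % 2 = 1 → dist (c (s i)) z₀ ≤ r₁)

/-- **RootAnnulusCrossingTight** (residual atom 1, Euclidean form): K-fold spirals of the critical
SAW around its ROOT are rare when both the multiplicity `K` and the aspect `M` are large,
uniformly in the (small, fixed) scale: `∀ η ∃ K₀ M₀ r₀, ∀ K ≥ K₀, M ≥ M₀, r ≤ r₀, ∀ᶠ δ,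
P[2K crossings of A(a; r, M r)] ≤ η`. Weaker than any fixed-`k` arm estimate (the crux is the
case `K = 1`, `M → ∞` at fixed outer scale) and than Kemppainen–Smirnov regularity (annealed,
unconditional, root only). The line needs its CONFORMAL-annulus form `φ(A_ℍ(r', M r'))` for
general Jordan `D`; for `D` John / quasidisc near `a` the two agree up to constants. -/
def RootAnnulusCrossingTight : Prop :=
  ∀ (D : DobrushinDomain) (a b : ℝ → Site 2), IsEndpointApprox D a b →
    ∀ η : ℝ, 0 < η → ∃ (K₀ : ℕ) (M₀ r₀ : ℝ), 1 < M₀ ∧ 0 < r₀ ∧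
      ∀ (K : ℕ) (M r : ℝ), K₀ ≤ K → M₀ ≤ M → 0 < r → r ≤ r₀ →
        ∀ᶠ δ in 𝓝[>] (0 : ℝ), law D.carrier δ (a δ) (b δ)
          {γ | HasRootCrossings K (D.pt 0) r (M * r) (γ.walk.toCurve (meshPoint δ))}
            ≤ ENNReal.ofReal η

/-- **NoMacroscopicN** (residual atom 2 = the crux at the single coarsest scale; the exact shape
of the Sheffield–Sun N-curve, REFUTATION.md on stmt-18005): after visiting `B̄(b, ρ)` the walk
does not come back within `ρ'` of `a`, with probability `→ 1` as `(ρ, ρ') → 0`, uniformly in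
small `δ`. Trivially implied by the crux (`ε := |a - b|/2`). -/
def NoMacroscopicN : Prop :=
  ∀ (D : DobrushinDomain) (a b : ℝ → Site 2), IsEndpointApprox D a b →
    ∀ η : ℝ, 0 < η → ∃ ρ ρ' : ℝ, 0 < ρ ∧ 0 < ρ' ∧ ∀ᶠ δ in 𝓝[>] (0 : ℝ),
      law D.carrier δ (a δ) (b δ) {γ | ∃ s t : unitInterval, s < t ∧
        dist (γ.walk.toCurve (meshPoint δ) s) (D.pt 1) ≤ ρ ∧
        dist (γ.walk.toCurve (meshPoint δ) t) (D.pt 0) ≤ ρ'} ≤ ENNReal.ofReal η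

/-- **ExactRootTouchRare** (technical leak of the trimming attachment): after being `ε`-far from
`a`, the polyline does not pass EXACTLY through the marked point `D.pt 0` (possible at all only if
`D.pt 0` lies on a closed lattice edge of `Ω_δ` for arbitrarily small `δ`, e.g. an inward cusp of
`∂D` at `a` meeting the lattice; vacuous for domains without such contact). -/
def ExactRootTouchRare : Prop :=
  ∀ (D : DobrushinDomain) (a b : ℝ → Site 2), IsEndpointApprox D a b →
    ∀ ε : ℝ, 0 < ε → ∀ η : ℝ, 0 < η → ∀ᶠ δ in 𝓝[>] (0 : ℝ),
      law D.carrier δ (a δ) (b δ) {γ | ∃ s t : unitInterval, s < t ∧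
        ε ≤ dist (γ.walk.toCurve (meshPoint δ) s) (D.pt 0) ∧
        γ.walk.toCurve (meshPoint δ) t = D.pt 0} ≤ ENNReal.ofReal η

/-! ## §5 The transfer (composition claim of the line; NOT proved here) -/

/-- **SqueezeTransfer** — the line's claim: two-sided driving convergence (the route's own
`ForwardDriving`, used for `D` and for `D.swap` through `LawReversal`) plus the exposure lemma and
the SLE base-separation estimate reduce `NoDeepReturn` to the two residual atoms (spirals with
`K, M → ∞`; the single-scale N) and the trimming leak. The glue also consumes standard facts
folded into the stubs' proofs: Beurling's estimate, continuity of `x^±` in `W`, portmanteau for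
`TendstoLaw` on `C([0,T])`, continuity of the boundary extension of `φ` at `0 ↦ a`, `∞ ↦ b`,
and "hulls of capacity `> T` meet `B(b, ρ(T))`". -/
def SqueezeTransfer : Prop :=
  Summit.CriticalPhenomena.SAWScalingLimit.Theses.SAWReversalUpgrade.ForwardDriving →
  Summit.CriticalPhenomena.SAWScalingLimit.Theses.SAWReversalUpgrade.LawReversal →
  ExposureBound → SLEBaseSeparation → RootAnnulusCrossingTight → NoMacroscopicN →
  ExactRootTouchRare → Crux

/-! ## §6 Sanity: the coarsest-scale atom IS implied by the crux (so it is a weakening) -/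

/-- `NoDeepReturn → NoMacroscopicN`: take `ε := dist a b / 2`; a visit to `B̄(b, ρ)` with
`ρ ≤ dist a b / 2` is `ε`-far from `a`. -/
theorem noMacroscopicN_of_crux (h : Crux) : NoMacroscopicN := by
  intro D a b hab η hη
  have hne : D.pt 0 ≠ D.pt 1 := fun h01 => by
    have := D.pt_injective h01
    exact absurd this (by decide)
  have hd : 0 < dist (D.pt 0) (D.pt 1) := dist_pos.2 hne
  obtain ⟨r, hr, hev⟩ := h D a b hab (dist (D.pt 0) (D.pt 1) / 2) (half_pos hd) η hη
  refine ⟨dist (D.pt 0) (D.pt 1) / 2, r, half_pos hd, hr, ?_⟩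
  filter_upwards [hev] with δ hδ
  refine le_trans (measure_mono ?_) hδ
  rintro γ ⟨s, t, hst, hs, ht⟩
  refine ⟨s, t, hst, ?_, ht⟩
  have h3 := dist_triangle (D.pt 0) (γ.walk.toCurve (meshPoint δ) s) (D.pt 1)
  rw [dist_comm (D.pt 0) (γ.walk.toCurve (meshPoint δ) s)] at h3
  linarith

end Summit.CriticalPhenomena.SAWScalingLimit.Cruxes.NoDeepReturn.ShieldSqueeze

end
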